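import Summits.CriticalPhenomena.PercolationContinuityZ3.Theorems.PercNearOneGluingNoHeavyQuantKnShiftNumeric
import Summits.CriticalPhenomena.PercolationContinuityZ3.Theorems.PercNearOneGluingNoHeavyQuantKnOrbitHigherD
import HarnessLib

/-!
# QUANT lane, PAPER-2 track (i) ARM-2 (constants bookkeeper): the `d = 3` numeral pipeline of `…QuantKnShiftNumeric` made GENERIC IN `d`
# (every `d`-dependent numeral a hypothesis), for the height offset `knShiftC d = 6` at `d = 4, 5, 6` (instances: `…QuantKnShiftNumericHigherD`)

builds on p205010 (kernel theorem, internal audit signed; external expert review pending)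

Cell `prim-quant`, seat `prim-quant-arm-2` (explicit constants of the rate chain); memo `run/shared/lean/prim/quant/prim-quant-arm-2/RATE-CONSTANTS.md`.
The `d = 3` file `…QuantKnShiftNumeric` (p4 g2, p211861) certified `knShiftC 3 = 6`; the orbit-defect sandwiches for `d = 4, 5, 6` are kernel
(`…QuantKnOrbitHigherD`, p3 g4, p213528) but their displays `oneArm_explicit_rate_logStar_half_orbit_numeral_four/five/six` keep `knShiftC d`
SYMBOLIC.  This file makes the `d = 3` numeral pipeline GENERIC IN `d` (every `d`-dependent numeral enters as a hypothesis discharged by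
`norm_num` in the instance file; exponents of `2` are bookkept as in `PowTwo`, so no large power is evaluated — note `norm_num` evaluates
`2^n` only for `n ≤ 256`, hence `PowTwo.rle_of_mul3`).  Generic lemmas: `aknKappa_le_of` (`aknKappa d (1/64) ≤ 2^(a₁+2E)`), `dktK_le_of`,
`dktN1_le_of` (`≤ 2^(8(K+5))`), `knDeltaE_ge_of` (`(1/2)^t ≤ knDeltaE d`), `knTE_le_of`, `knLE_le_of`, `knU_le_of` (`≤ 2^((2t+1)·knAexp d)`),
`knM1_le_of`, `knS1_le_of`, `knN2_le_of`, `knP_le_of`, the relaxed `knShiftC_le_six_of'` (`k < 2^j`, `j ≤ 65536`), the lower bound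
`dktN1_ge_of` (`2^(8a) ≤ dktN1 d (1/64)` from `a ≤ E_d`), and the assembly `knShiftC_eq_six_of`.  Pure numeral bookkeeping; class unchanged.  [cite: KozmaNitzan2024, §4 Theorem 6] [cite: DuminilcopinKozmaTassion2020, Proposition 1 and §7] [cite: Cerf2015, Prop 5.2]
-/

noncomputable section

namespace Summit.CriticalPhenomena.PercolationContinuityZ3.Theorems.Quant

open Literature.Probability.Percolation Literature.Probability.LatticeModels
open Literature.Probability.Percolation.AKN
open PowTwo

variable {d : ℕ}

/-! ### §1. Generic-in-`d` numeral pipeline (every `d`-dependent numeral is a hypothesis) -/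

/-- `critDelta d = 1/64` for `1 ≤ d ≤ 32`. [folklore] -/
theorem critDelta_eq_of_le (hd1 : 1 ≤ d) (hd : d ≤ 32) : critDelta d = 1 / 64 := by
  unfold critDelta
  refine min_eq_right ?_
  have hd' : (d : ℝ) ≤ 32 := by exact_mod_cast hd
  have hd0 : (0 : ℝ) < d := by exact_mod_cast hd1
  rw [div_le_div_iff₀ (by norm_num) (by positivity)]
  linarith

/-- `knB d = 64` for `d ≤ 32`. [folklore] -/
theorem knB_eq_of_le (hd : d ≤ 32) : knB d = 64 := by
  unfold knB; exact max_eq_right (by omega)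

/-- `Real.sqrt x ≤ 2^k` from `x ≤ 2^(2k)`. [folklore] -/
theorem PowTwo.sqrt_le (k : ℕ) {x : ℝ} (h : x ≤ (2 : ℝ) ^ (2 * k)) : Real.sqrt x ≤ (2 : ℝ) ^ k := by
  rw [show (2 : ℝ) ^ (2 * k) = ((2 : ℝ) ^ k) ^ 2 by rw [← pow_mul, mul_comm]] at h
  exact (Real.sqrt_le_sqrt h).trans (by rw [Real.sqrt_sq (by positivity)])

/-- Real: `x ≤ 2^a · 2^b · 2^e`, `a + b + e ≤ c` ⇒ `x ≤ 2^c` (keeps every evaluated power `≤ 2^256`, `norm_num`'s evaluation range). [folklore] -/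
theorem PowTwo.rle_of_mul3 (c : ℕ) {x : ℝ} {a b e : ℕ} (h : x ≤ (2 : ℝ) ^ a * 2 ^ b * 2 ^ e) (habc : a + b + e ≤ c) :
    x ≤ (2 : ℝ) ^ c :=
  h.trans (by rw [← pow_add, ← pow_add]; exact pow_le_pow_right₀ (by norm_num) habc)

/-- **Generic `aknKappa d (1/64) ≤ 2^m`** from numeral hypotheses on the exponent `E_d` and the two prefactors. [cite: Cerf2015, Prop 5.2] -/
theorem aknKappa_le_of (d : ℕ) {E a₁ a₂ m : ℕ}
    (hE : (2 * (d : ℝ) + 1 / 2) ^ 2 / (4 * (2 * (1 / 64 : ℝ) ^ 2 * (1 - 1 / 64) ^ 2)) ≤ (E : ℝ))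
    (hpre : (3 : ℝ) ^ d * (16 * (d : ℝ) ^ 2 / (1 / 64)) ≤ (2 : ℝ) ^ a₁)
    (hsq : (3 : ℝ) ^ d * Real.sqrt (8 * (d : ℝ) ^ 2 * 3 ^ (d - 1)) ≤ (2 : ℝ) ^ a₂)
    (h1 : a₁ + 2 * E ≤ m) (h2 : a₂ ≤ m) (h3 : 2 ≤ m) :
    aknKappa d (1 / 64) ≤ (2 : ℝ) ^ m := by
  have hexp : Real.exp ((2 * (d : ℝ) + 1 / 2) ^ 2 / (4 * (2 * (1 / 64 : ℝ) ^ 2 * (1 - 1 / 64) ^ 2))) ≤ (2 : ℝ) ^ (2 * E) :=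
    (Real.exp_le_exp.2 hE).trans (exp_nat_le_two_pow E)
  unfold aknKappa
  refine max_le (rle_of m (k := 2) (by norm_num) h3) (max_le (rle_of m hsq h2) ?_)
  exact rmul_le m hpre hexp (by positivity) (Real.exp_pos _).le h1

/-- **Generic `dktK d (1/64) ≤ 2^m`** from the `aknKappa` bound and a numeral bound on the remaining factors (`√2 ≤ 3/2`).
[cite: DuminilcopinKozmaTassion2020, §7] -/
theorem dktK_le_of (d : ℕ) {κb c m : ℕ} (hκ : aknKappa d (1 / 64) ≤ (2 : ℝ) ^ κb)
    (hC : (1 + 2 * (d : ℝ)) * (2 * (d : ℝ)) ^ (2 * d) / (1 / 64 : ℝ) ^ (2 * d + 3) * 7 ^ (4 * d ^ 2 + 4 * d : ℕ) *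
      ((d : ℝ) * (3 / 2)) * 2 ^ (2 * d) ≤ (2 : ℝ) ^ c)
    (h : c + κb ≤ m) : dktK d (1 / 64) ≤ (2 : ℝ) ^ m := by
  have hκ0 : 0 ≤ aknKappa d (1 / 64) := le_trans (by norm_num) (three_le_aknKappa d _)
  have hmin : min (1 / 64 : ℝ) (1 / 2) = 1 / 64 := by norm_num
  unfold dktK
  rw [hmin]
  have hs2 : Real.sqrt 2 ≤ 3 / 2 :=
    (Real.sqrt_le_sqrt (by norm_num : (2 : ℝ) ≤ (3 / 2) ^ 2)).trans (by rw [Real.sqrt_sq (by norm_num)])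
  have hs0 : 0 ≤ Real.sqrt 2 := Real.sqrt_nonneg 2
  have heq : (1 + 2 * (d : ℝ)) * (2 * (d : ℝ)) ^ (2 * d) / (1 / 64 : ℝ) ^ (2 * d + 3) * 7 ^ (4 * d ^ 2 + 4 * d : ℕ) *
        ((d : ℝ) * aknKappa d (1 / 64) * Real.sqrt 2) * 2 ^ (2 * d)
      = ((1 + 2 * (d : ℝ)) * (2 * (d : ℝ)) ^ (2 * d) / (1 / 64 : ℝ) ^ (2 * d + 3) * 7 ^ (4 * d ^ 2 + 4 * d : ℕ) *
          ((d : ℝ) * Real.sqrt 2) * 2 ^ (2 * d)) * aknKappa d (1 / 64) := by ring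
  rw [heq]
  refine rmul_le m (a := c) (b := κb) (hC.trans' ?_) hκ ?_ hκ0 h
  · gcongr
  · positivity

/-- **Generic `dktN1 d (1/64) ≤ 2^m`** from `dktK d (1/64) ≤ 2^k` (`(18K)^8 ≤ 2^(8(k+5))`). [cite: DuminilcopinKozmaTassion2020, Proposition 1] -/
theorem dktN1_le_of (d : ℕ) {k m : ℕ} (hK : dktK d (1 / 64) ≤ (2 : ℝ) ^ k) (h : 8 * (k + 5) ≤ m) (hm : 7 ≤ m) :
    dktN1 d (1 / 64) ≤ 2 ^ m := by
  have hK0 : 0 ≤ dktK d (1 / 64) := by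
    unfold dktK
    have := three_le_aknKappa d (min (1 / 64 : ℝ) (1 / 2))
    positivity
  have h18 : 18 * dktK d (1 / 64) ≤ (2 : ℝ) ^ (k + 5) :=
    rmul_le (k + 5) (a := 5) (by norm_num) hK (by norm_num) hK0 (by omega)
  have h8 : (18 * dktK d (1 / 64)) ^ 8 ≤ (2 : ℝ) ^ m := rpow_le m 8 h18 (by positivity) (by omega)
  unfold dktN1
  exact max_le_iff.2 ⟨le_of m (k := 7) (by norm_num) hm, ceil_le m h8⟩

/-- **Generic `(1/2)^t ≤ knDeltaE d`** from the numeral `(1/2)^t ≤ (2^{-32}/(96(d+1)))²/(200·25·2^37)` (`knK ≤ 25·2^37`). [folklore] (numeric) -/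
theorem knDeltaE_ge_of (d : ℕ) (hd1 : 1 ≤ d) {t : ℕ}
    (h : (1 / 2 : ℝ) ^ t ≤ ((1 / 2 : ℝ) ^ 32 / (96 * ((d : ℝ) + 1))) ^ 2 / (200 * (25 * 2 ^ 37))) :
    (1 / 2 : ℝ) ^ t ≤ knDeltaE d := by
  have hK : (knK : ℝ) ≤ 25 * 2 ^ 37 := by exact_mod_cast knK_le
  have hK0 : (0 : ℝ) < knK := by exact_mod_cast knK_pos
  have hε : knEps = (1 / 2) ^ 32 := rfl
  have hd0 : (0 : ℝ) < 96 * ((d : ℝ) + 1) := by positivity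
  have hτ : (knEps / (96 * ((d : ℝ) + 1))) ^ 2 ≤ knTau1 d := by
    unfold knTau1 knDelta knDeltaCorr
    refine le_min ?_ le_rfl
    apply pow_le_pow_left₀ (by have := knEps_pos; positivity)
    have := knEps_pos
    have h1d : (1 : ℝ) ≤ d := by exact_mod_cast hd1
    have hd1' : (192 : ℝ) ≤ 96 * ((d : ℝ) + 1) := by nlinarith
    exact div_le_div_of_nonneg_left this.le (by norm_num) hd1'
  unfold knDeltaE
  calc (1 / 2 : ℝ) ^ t ≤ (knEps / (96 * ((d : ℝ) + 1))) ^ 2 / (200 * (25 * 2 ^ 37)) := by rw [hε]; exact h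
    _ ≤ knTau1 d / (200 * (25 * 2 ^ 37)) := div_le_div_of_nonneg_right hτ (by norm_num)
    _ ≤ knTau1 d / (200 * (knK : ℝ)) :=
        div_le_div_of_nonneg_left (knTau1_pos d).le (by positivity) (by nlinarith)

/-- Generic `knTE d ≤ 2^t`. [folklore] -/
theorem knTE_le_of (d : ℕ) {t : ℕ} (h : (1 / 2 : ℝ) ^ t ≤ knDeltaE d) : knTE d ≤ 2 ^ t := by
  unfold knTE; exact ceil_le t (one_div_le t h)

/-- Generic `knLE d ≤ 2^ℓ` (`log(1/δ_E) ≤ t·log 2 ≤ t ≤ 2^ℓ`). [folklore] -/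
theorem knLE_le_of (d : ℕ) {t ℓ : ℕ} (h : (1 / 2 : ℝ) ^ t ≤ knDeltaE d) (ht : t ≤ 2 ^ ℓ) : knLE d ≤ 2 ^ ℓ := by
  unfold knLE
  refine ceil_le ℓ ?_
  have h1 := one_div_le t h
  have hδ := knDeltaE_pos d
  have h2 : Real.log (1 / knDeltaE d) ≤ Real.log (2 ^ t) := Real.log_le_log (by positivity) h1
  rw [Real.log_pow] at h2
  have hl2 := Real.log_two_lt_d9
  have hl0 : 0 < Real.log 2 := Real.log_pos (by norm_num)
  have ht' : (t : ℝ) ≤ (2 : ℝ) ^ ℓ := by exact_mod_cast ht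
  have : (t : ℝ) * Real.log 2 ≤ (t : ℝ) * 1 := mul_le_mul_of_nonneg_left (by linarith) (Nat.cast_nonneg t)
  linarith

/-- Generic `knU d ≤ 2^m` (`τ_U ≥ (1/2)^(2t+1)`, exponent `1/α_d = knAexp d`). [folklore] -/
theorem knU_le_of (d : ℕ) {t m : ℕ} (h : (1 / 2 : ℝ) ^ t ≤ knDeltaE d) (hm : (2 * t + 1) * knAexp d ≤ m) : knU d ≤ 2 ^ m := by
  unfold knU
  refine ceil_le m ?_
  rw [inv_dktAlpha, Real.rpow_natCast]
  have hτ : (1 / 2 : ℝ) ^ (2 * t + 1) ≤ knTauU d := by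
    unfold knTauU
    have h0 : (0 : ℝ) ≤ (1 / 2) ^ t := by positivity
    have h1 : ((1 / 2 : ℝ) ^ t) ^ 2 ≤ knDeltaE d ^ 2 := pow_le_pow_left₀ h0 h 2
    have h2 : (1 / 2 : ℝ) ^ (2 * t + 1) = ((1 / 2 : ℝ) ^ t) ^ 2 / 2 := by
      rw [div_eq_mul_one_div (((1 / 2 : ℝ) ^ t) ^ 2), ← pow_mul, ← pow_succ, mul_comm]
    rw [h2]
    exact div_le_div_of_nonneg_right h1 (by norm_num)
  have hinv : (knTauU d)⁻¹ ≤ 2 ^ (2 * t + 1) := by rw [inv_eq_one_div]; exact one_div_le _ hτ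
  exact rpow_le m (knAexp d) hinv (inv_nonneg.2 (knTauU_pos d).le) hm

/-- Generic `knM1 d ≤ 2^m` (`1 ≤ d ≤ 32`, so `critDelta d = 1/64`). [folklore] -/
theorem knM1_le_of (d : ℕ) (hd1 : 1 ≤ d) (hd : d ≤ 32) {n u m : ℕ} (hN : dktN1 d (1 / 64) ≤ 2 ^ n) (hU : knU d ≤ 2 ^ u)
    (hu : u ≤ n) (hm : n + 1 ≤ m) (h3 : 3 ≤ m) : knM1 d ≤ 2 ^ m := by
  unfold knM1
  rw [critDelta_eq_of_le hd1 hd]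
  exact add_le m (max_le_iff.2 ⟨hN, le_of n hU hu⟩) (show 3 ≤ 2 ^ 2 by norm_num) hm h3

/-- Generic `knS1 d ≤ 2^s`. [folklore] -/
theorem knS1_le_of (d : ℕ) {m₁ g s : ℕ} (hM : knM1 d ≤ 2 ^ m₁) (hg : 2 * d + 1 ≤ 2 ^ g) (hm : 2 ≤ m₁)
    (hs : g + d * (m₁ + 2) + 1 ≤ s) : knS1 d ≤ 2 ^ s := by
  unfold knS1
  have h1 : 2 * knM1 d + 3 ≤ 2 ^ (m₁ + 2) :=
    add_le (m₁ + 2) (mul_le (m₁ + 1) (a := 1) (by norm_num) hM (by omega)) (show 3 ≤ 2 ^ 2 by norm_num) (by omega) (by omega)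
  have h2 : (2 * d + 1) * (2 * knM1 d + 3) ^ d ≤ 2 ^ (g + d * (m₁ + 2)) :=
    mul_le _ hg (pow_le (d * (m₁ + 2)) d h1 (by rw [mul_comm])) le_rfl
  exact add_le s h2 (show 1 ≤ 2 ^ 0 by norm_num) hs (by omega)

/-- Generic `knN2 d ≤ 2^n`. [folklore] -/
theorem knN2_le_of (d : ℕ) {m₁ ℓ n : ℕ} (hM : knM1 d ≤ 2 ^ m₁) (hL : knLE d ≤ 2 ^ ℓ) (hm : 5 ≤ m₁)
    (hn : ℓ + d * (m₁ + 4) ≤ n) : knN2 d ≤ 2 ^ n := by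
  unfold knN2
  have h1 : 8 * knM1 d + 17 ≤ 2 ^ (m₁ + 4) :=
    add_le (m₁ + 4) (mul_le (m₁ + 3) (a := 3) (by norm_num) hM (by omega)) (show 17 ≤ 2 ^ 5 by norm_num) (by omega) (by omega)
  exact mul_le n hL (pow_le (d * (m₁ + 4)) d h1 (by rw [mul_comm])) hn

/-- Generic `knP d ≤ 2^101` for `1761000(d+1) ≤ 2^24` (i.e. `d ≤ 8`). [folklore] -/
theorem knP_le_of (d : ℕ) (hd : 1761000 * (d + 1) ≤ 2 ^ 24) : knP d ≤ 2 ^ 101 := by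
  unfold knP
  have hA : 25 * knK ≤ 2 ^ 47 := mul_le 47 (show 25 ≤ 2 ^ 5 by norm_num) knK_le_two_pow (by norm_num)
  have hB1 : 800 * knK ≤ 2 ^ 52 := mul_le 52 (show 800 ≤ 2 ^ 10 by norm_num) knK_le_two_pow (by norm_num)
  have hB12 : 800 * knK + 1761000 * (d + 1) ≤ 2 ^ 53 := add_le 53 hB1 hd (by norm_num) (by norm_num)
  have hB : 800 * knK + 1761000 * (d + 1) + 1219 ≤ 2 ^ 54 := add_le 54 hB12 (show 1219 ≤ 2 ^ 11 by norm_num) (by norm_num) (by norm_num)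
  exact mul_le 101 hA hB (by norm_num)

/-- Generic: `knShiftC d ≤ 6` as soon as `knG d 1 + knShiftE d + 1 ≤ 2^k` with `k < 2^j`, `j ≤ 2 ↑↑ 4 = 65536`
(so `2^k < 2 ↑↑ 6`).  Relaxes `knShiftC_le_six_of` (`j = 22`) for the larger `d = 5, 6` exponents. [folklore] -/
theorem knShiftC_le_six_of' (d : ℕ) {k j : ℕ} (hy : knG d 1 + knShiftE d + 1 ≤ 2 ^ k) (hk : k < 2 ^ j) (hj : j ≤ 65536) :
    knShiftC d ≤ 6 := by
  unfold knShiftC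
  set y := knG d 1 + knShiftE d + 1 with hydef
  have hy1 : 1 ≤ y := Nat.le_add_left 1 _
  have hj' : j ≤ tower 2 4 := by rw [tower_two_four]; exact hj
  have hk5 : k < tower 2 5 := by
    rw [show (5 : ℕ) = 4 + 1 from rfl, tower_succ]
    exact lt_of_lt_of_le hk (Nat.pow_le_pow_right (by norm_num) hj')
  have hlt : y < tower 2 6 := by
    rw [show (6 : ℕ) = 5 + 1 from rfl, tower_succ]
    exact lt_of_le_of_lt hy (Nat.pow_lt_pow_right (by norm_num) hk5)
  suffices h : logStar 2 y ≤ 5 from Nat.succ_le_succ h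
  by_contra hc
  push Not at hc
  have h6 : tower 2 6 ≤ y := (le_logStar_iff (le_refl 2) hy1).1 hc
  exact absurd (lt_of_le_of_lt h6 hlt) (lt_irrefl _)

/-- **Generic lower bound `2^(8a) ≤ dktN1 d (1/64)`** from `a ≤ E_d` (`exp E_d ≥ 2^a` using `exp 1 ≥ 2`) and the numeral facts that the
remaining factors of `aknKappa` and `dktK` are `≥ 1`. [cite: DuminilcopinKozmaTassion2020, Proposition 1] -/
theorem dktN1_ge_of (d : ℕ) {a : ℕ}
    (hE : (a : ℝ) ≤ (2 * (d : ℝ) + 1 / 2) ^ 2 / (4 * (2 * (1 / 64 : ℝ) ^ 2 * (1 - 1 / 64) ^ 2)))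
    (hpre : (1 : ℝ) ≤ (3 : ℝ) ^ d * (16 * (d : ℝ) ^ 2 / (1 / 64)))
    (hA : (1 : ℝ) ≤ (1 + 2 * (d : ℝ)) * (2 * (d : ℝ)) ^ (2 * d) / (1 / 64 : ℝ) ^ (2 * d + 3) * 7 ^ (4 * d ^ 2 + 4 * d : ℕ))
    (hB : (1 : ℝ) ≤ (d : ℝ) * Real.sqrt 2) (hC : (1 : ℝ) ≤ (2 : ℝ) ^ (2 * d)) :
    2 ^ (8 * a) ≤ dktN1 d (1 / 64) := by
  -- `aknKappa ≥ 2^a`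
  have hκ : (2 : ℝ) ^ a ≤ aknKappa d (1 / 64) := by
    unfold aknKappa
    refine le_trans ?_ (le_max_right _ _)
    refine le_trans ?_ (le_max_right _ _)
    have hexp : (2 : ℝ) ^ a ≤ Real.exp ((2 * (d : ℝ) + 1 / 2) ^ 2 / (4 * (2 * (1 / 64 : ℝ) ^ 2 * (1 - 1 / 64) ^ 2))) := by
      have h2 : (2 : ℝ) ≤ Real.exp 1 := by have := Real.add_one_le_exp (1 : ℝ); linarith
      calc (2 : ℝ) ^ a ≤ (Real.exp 1) ^ a := pow_le_pow_left₀ (by norm_num) h2 _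
        _ = Real.exp ((a : ℕ) * 1) := (Real.exp_nat_mul 1 a).symm
        _ ≤ _ := Real.exp_le_exp.2 (by linarith)
    calc (2 : ℝ) ^ a = 1 * 2 ^ a := (one_mul _).symm
      _ ≤ (3 : ℝ) ^ d * (16 * (d : ℝ) ^ 2 / (1 / 64)) *
          Real.exp ((2 * (d : ℝ) + 1 / 2) ^ 2 / (4 * (2 * (1 / 64 : ℝ) ^ 2 * (1 - 1 / 64) ^ 2))) :=
          mul_le_mul hpre hexp (by positivity) (by positivity)
  -- `dktK ≥ aknKappa`
  have hκK : aknKappa d (1 / 64) ≤ dktK d (1 / 64) := by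
    unfold dktK
    have hmin : min (1 / 64 : ℝ) (1 / 2) = 1 / 64 := by norm_num
    rw [hmin]
    have hκ0 : 0 ≤ aknKappa d (1 / 64) := le_trans (by norm_num) (three_le_aknKappa d (1 / 64))
    set P : ℝ := (1 + 2 * (d : ℝ)) * (2 * (d : ℝ)) ^ (2 * d) / (1 / 64 : ℝ) ^ (2 * d + 3) * 7 ^ (4 * d ^ 2 + 4 * d : ℕ) with hP
    have hP0 : 0 ≤ P := zero_le_one.trans hA
    have hinner : 1 * aknKappa d (1 / 64) ≤ ((d : ℝ) * Real.sqrt 2) * aknKappa d (1 / 64) :=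
      mul_le_mul_of_nonneg_right hB hκ0
    have h1 : 1 * (1 * aknKappa d (1 / 64)) ≤ P * (((d : ℝ) * Real.sqrt 2) * aknKappa d (1 / 64)) :=
      mul_le_mul hA hinner (by positivity) hP0
    have h2 : 1 * (1 * aknKappa d (1 / 64)) * 1 ≤ P * (((d : ℝ) * Real.sqrt 2) * aknKappa d (1 / 64)) * (2 : ℝ) ^ (2 * d) :=
      mul_le_mul h1 hC zero_le_one (by positivity)
    calc aknKappa d (1 / 64) = 1 * (1 * aknKappa d (1 / 64)) * 1 := by ring
      _ ≤ P * (((d : ℝ) * Real.sqrt 2) * aknKappa d (1 / 64)) * (2 : ℝ) ^ (2 * d) := h2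
      _ = P * ((d : ℝ) * aknKappa d (1 / 64) * Real.sqrt 2) * 2 ^ (2 * d) := by ring
  -- `(18 K)^8 ≥ 2^(8a)`
  unfold dktN1
  refine le_max_of_le_right ?_
  have hK := hκ.trans hκK
  have h0 : (0 : ℝ) ≤ 2 ^ a := pow_nonneg (by norm_num) _
  have hK0 : (0 : ℝ) ≤ dktK d (1 / 64) := h0.trans hK
  have h18 : dktK d (1 / 64) ≤ 18 * dktK d (1 / 64) := by
    have := mul_le_mul_of_nonneg_right (show (1 : ℝ) ≤ 18 by norm_num) hK0
    rwa [one_mul] at this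
  have hreal : ((2 ^ (8 * a) : ℕ) : ℝ) ≤ (18 * dktK d (1 / 64)) ^ 8 := by
    have hc : ((2 ^ (8 * a) : ℕ) : ℝ) = ((2 : ℝ) ^ a) ^ 8 := by
      rw [Nat.cast_pow, Nat.cast_ofNat, ← pow_mul, mul_comm]
    rw [hc]
    exact (pow_le_pow_left₀ h0 hK 8).trans (pow_le_pow_left₀ hK0 h18 8)
  calc 2 ^ (8 * a) = ⌈((2 ^ (8 * a) : ℕ) : ℝ)⌉₊ := (Nat.ceil_natCast _).symm
    _ ≤ ⌈(18 * dktK d (1 / 64)) ^ 8⌉₊ := Nat.ceil_mono hreal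

/-- Generic: `knShiftC d = 6` from an upper exponent `k < 2^j` (`j ≤ 65536`) and the lower bound `dktN1 d (critDelta d) ≥ 2^65536`. [folklore] -/
theorem knShiftC_eq_six_of (d : ℕ) (hd1 : 1 ≤ d) (hd : d ≤ 32) {k j : ℕ} (hy : knG d 1 + knShiftE d + 1 ≤ 2 ^ k) (hk : k < 2 ^ j)
    (hj : j ≤ 65536) (hlow : 2 ^ (8 * 8192) ≤ dktN1 d (1 / 64)) : knShiftC d = 6 := by
  refine le_antisymm (knShiftC_le_six_of' d hy hk hj) (six_le_knShiftC_of d ?_)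
  rw [← critDelta_eq_of_le hd1 hd] at hlow
  have hk' : tower 2 4 ≤ 8 * 8192 := by rw [tower_two_four]
  exact (PowTwo.tower_two_five_le (8 * 8192) hlow hk').trans (dktN1_le_knG_one hd1)

end Summit.CriticalPhenomena.PercolationContinuityZ3.Theorems.Quant

end
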